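import Mathlib
import Summits.Ventures.PercRepro2.Defs
import Summits.Ventures.PercRepro2.Graph
import Summits.Ventures.PercRepro2.OneColourSwitch
import Summits.Ventures.PercRepro2.RegionHubSign
import Summits.Ventures.PercRepro2.SideSwitch
import Summits.Ventures.PercRepro2.SideSwitchClosed

/-!
# The two-colour worlds of a TERMINAL SET and the side switch of a closed set (blind cell
PercRepro2, p3 g21, 2026-08-27; `proofs/P3-CPNC.md` §18a–b)

For a terminal set `H ⊆ V` and a colouring `ω` let `K_H = ⋃_{h ∈ H} C_Y(h)` and
`M_H = ⋃_{h ∈ H} C_W(h)` be its two one-colour worlds (`KH`, `MH`), `sepH` the two-colour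
separation of `p, q` from `H` (`p, q ∉ K_H ∪ M_H`) and `DZeroH` the absence of a doubly reached
vertex outside `H`.  Flipping every edge touching a set `C ⊆ (K_H ∪ M_H) ∖ H` closed under
adjacency inside `(K_H ∪ M_H) ∖ H` exchanges the sides of `C` (`KH_flipTouch_of_closed`,
`MH_flipTouch_of_closed`, `sepH_flipTouch_of_closed`) — `SideSwitchClosed` with `H` in place of
`{r, s}`; the proofs are the same closedness arguments.  Own work; std axioms.
-/

namespace Summit.Ventures.PercRepro2

namespace TermSwitch

open Finset Classical RegionHub OneColourSwitch SideSwitch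

variable {V : Type*} {E : Type*}
variable (ends : E → Sym2 V)

/-- The `Y`-world of the terminal set `H`: the union of the open clusters of its vertices. -/
def KH (H : Set V) (ω : Config E) : Set V := expl ends H ω

/-- The `W`-world of the terminal set `H`: the union of the closed clusters of its vertices. -/
def MH (H : Set V) (ω : Config E) : Set V := expl ends H (OneColourSwitch.compl ω)

/-- The two-colour separation of `p, q` from the terminal set `H`: `p, q ∉ K_H ∪ M_H`. -/
def sepH (p q : V) (H : Set V) (ω : Config E) : Prop :=
  p ∉ KH ends H ω ∧ q ∉ KH ends H ω ∧ p ∉ MH ends H ω ∧ q ∉ MH ends H ω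

/-- No vertex outside `H` lies in both worlds of `H`. -/
def DZeroH (H : Set V) (ω : Config E) : Prop :=
  ∀ x, x ∉ H → x ∈ KH ends H ω → x ∉ MH ends H ω

/-- The sided vertices of `H`: `(K_H ∪ M_H) ∖ H`. -/
def sidedH (H : Set V) (ω : Config E) : Set V :=
  {x | x ∈ KH ends H ω ∪ MH ends H ω ∧ x ∉ H}

variable {ends}

/-- Membership in the `Y`-world. -/
lemma mem_KH_iff {H : Set V} {ω : Config E} {x : V} :
    x ∈ KH ends H ω ↔ ∃ h ∈ H, Conn ends ω h x := Iff.rfl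

/-- Membership in the `W`-world. -/
lemma mem_MH_iff {H : Set V} {ω : Config E} {x : V} :
    x ∈ MH ends H ω ↔ ∃ h ∈ H, Conn ends (OneColourSwitch.compl ω) h x := Iff.rfl

/-- The `Y`-world of the flipped colouring is the `W`-world. -/
lemma KH_compl (H : Set V) (ω : Config E) :
    KH ends H (OneColourSwitch.compl ω) = MH ends H ω := rfl

/-- The `W`-world of the flipped colouring is the `Y`-world. -/
lemma MH_compl (H : Set V) (ω : Config E) :
    MH ends H (OneColourSwitch.compl ω) = KH ends H ω := by
  simp only [MH, KH, OneColourSwitch.compl_compl]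

/-- A terminal lies in the `Y`-world. -/
lemma mem_KH_of_mem {H : Set V} {h : V} (hh : h ∈ H) (ω : Config E) : h ∈ KH ends H ω :=
  ⟨h, hh, conn_refl _ _ _⟩

/-- A terminal lies in the `W`-world. -/
lemma mem_MH_of_mem {H : Set V} {h : V} (hh : h ∈ H) (ω : Config E) : h ∈ MH ends H ω :=
  mem_KH_of_mem hh (OneColourSwitch.compl ω)

/-- `DZeroH` is invariant under the colour flip. -/
lemma DZeroH_compl {H : Set V} {ω : Config E} (h : DZeroH ends H ω) :
    DZeroH ends H (OneColourSwitch.compl ω) := by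
  intro x hxH hx hM
  rw [KH_compl] at hx
  rw [MH_compl] at hM
  exact h x hxH hM hx

/-- `sepH` is invariant under the colour flip. -/
lemma sepH_compl {p q : V} {H : Set V} {ω : Config E} :
    sepH ends p q H (OneColourSwitch.compl ω) ↔ sepH ends p q H ω := by
  simp only [sepH, KH_compl, MH_compl]
  constructor
  · rintro ⟨h1, h2, h3, h4⟩; exact ⟨h3, h4, h1, h2⟩
  · rintro ⟨h1, h2, h3, h4⟩; exact ⟨h3, h4, h1, h2⟩

/-- The `Y`-world is closed under open edges. -/
lemma mem_KH_of_open {H : Set V} {ω : Config E} {x y : V} {e : E} (hx : x ∈ KH ends H ω)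
    (he : ω e = true) (hends : ends e = s(x, y)) : y ∈ KH ends H ω := by
  obtain ⟨h, hh, hc⟩ := hx
  exact ⟨h, hh, conn_trans hc (conn_of_openAdj ⟨e, he, hends⟩)⟩

/-- The `W`-world is closed under closed edges. -/
lemma mem_MH_of_closed {H : Set V} {ω : Config E} {x y : V} {e : E} (hx : x ∈ MH ends H ω)
    (he : ω e = false) (hends : ends e = s(x, y)) : y ∈ MH ends H ω :=
  mem_KH_of_open (ω := OneColourSwitch.compl ω) hx (by simp [OneColourSwitch.compl, he]) hends

/-- A terminal has no edge to a vertex outside `K_H ∪ M_H`. -/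
lemma not_edge_H_outside {H : Set V} {ω : Config E} {h y : V} (hh : h ∈ H) {e : E}
    (hyK : y ∉ KH ends H ω) (hyM : y ∉ MH ends H ω) (hends : ends e = s(h, y)) : False := by
  cases he : ω e
  · exact hyM (mem_MH_of_closed (mem_MH_of_mem hh ω) he hends)
  · exact hyK (mem_KH_of_open (mem_KH_of_mem hh ω) he hends)

/-- An edge leaving the `W`-world is open. -/
lemma open_of_mem_MH_of_not_mem {H : Set V} {ω : Config E} {x y : V} {e : E}
    (hx : x ∈ MH ends H ω) (hy : y ∉ MH ends H ω) (hends : ends e = s(x, y)) :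
    ω e = true := by
  cases h : ω e
  · exact (hy (mem_MH_of_closed hx h hends)).elim
  · rfl

/-- The sided set is invariant under the colour flip. -/
lemma sidedH_compl (H : Set V) (ω : Config E) :
    sidedH ends H (OneColourSwitch.compl ω) = sidedH ends H ω := by
  ext x
  simp only [sidedH, KH_compl, MH_compl, Set.mem_setOf_eq, Set.mem_union]
  constructor
  · rintro ⟨h, hH⟩; exact ⟨h.symm, hH⟩
  · rintro ⟨h, hH⟩; exact ⟨h.symm, hH⟩

/-! ## The side switch of a closed set -/

/-- **The side switch of a closed set, `Y`-world**: for `C ⊆ (K_H ∪ M_H) ∖ H` closed under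
adjacency inside the sided set, `K_H(ω ⊕ touches C) = (K_H ∖ C) ∪ (C ∩ M_H)`. -/
theorem KH_flipTouch_of_closed {H : Set V} {ω : Config E}
    {C : Set V} (hCH : ∀ x ∈ C, x ∉ H) (hcl : ClosedIn ends (sidedH ends H ω) C) :
    KH ends H (flipTouch ends C ω) = (KH ends H ω \ C) ∪ (C ∩ MH ends H ω) := by
  set ω' := flipTouch ends C ω with hω'
  have hmem : ∀ {e : E}, e ∈ touches ends C → ω' e = !ω e := fun het => by
    rw [hω', flipTouch_of_mem ends het]
  have hnot : ∀ {e : E}, e ∉ touches ends C → ω' e = ω e := fun hnt => by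
    rw [hω', flipTouch_of_notMem ends hnt]
  -- a vertex of `K_H ∪ M_H` reached from `C` by an edge is in `C` or is a terminal
  have hstep : ∀ {e : E} {x y : V}, ends e = s(x, y) → x ∈ C →
      y ∈ KH ends H ω ∪ MH ends H ω → y ∉ C → y ∈ H := by
    intro e x y hends hx hy hyC
    by_contra hne
    exact hyC (hcl e x y hends hx ⟨hy, hne⟩)
  apply Set.Subset.antisymm
  · have hcl' : ∀ x ∈ (KH ends H ω \ C) ∪ (C ∩ MH ends H ω), ∀ y,
        (openGraph ends ω').Adj x y → y ∈ (KH ends H ω \ C) ∪ (C ∩ MH ends H ω) := by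
      intro x hx y hxy
      obtain ⟨_, e, he, hends⟩ := openGraph_adj.1 hxy
      have hyx : ends e = s(y, x) := by rw [hends, Sym2.eq_swap]
      rcases hx with ⟨hxK, hxC⟩ | ⟨hxC, hxM⟩
      · by_cases hyC : y ∈ C
        · have het : e ∈ touches ends C := mem_touches_of_ends hends (Or.inr hyC)
          have he0 : ω e = false := by
            have := hmem het
            rw [he] at this
            simpa using this.symm
          -- `x` is a terminal
          have hxH : x ∈ H := hstep hyx hyC (Or.inl hxK) hxC
          exact Or.inr ⟨hyC, mem_MH_of_closed (mem_MH_of_mem hxH ω) he0 hends⟩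
        · have hnt : e ∉ touches ends C := not_mem_touches_of_ends hends hxC hyC
          have he1 : ω e = true := by rw [← hnot hnt]; exact he
          exact Or.inl ⟨mem_KH_of_open hxK he1 hends, hyC⟩
      · have het : e ∈ touches ends C := mem_touches_of_ends hends (Or.inl hxC)
        have he0 : ω e = false := by
          have := hmem het
          rw [he] at this
          simpa using this.symm
        have hyM : y ∈ MH ends H ω := mem_MH_of_closed hxM he0 hends
        by_cases hyC : y ∈ C
        · exact Or.inr ⟨hyC, hyM⟩
        · by_cases hyK : y ∈ KH ends H ω
          · exact Or.inl ⟨hyK, hyC⟩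
          · exact (hyK (mem_KH_of_mem (hstep hends hxC (Or.inr hyM) hyC) ω)).elim
    intro x hx
    obtain ⟨h, hh, hc⟩ := hx
    exact mem_of_conn_of_closed hcl' (Or.inl ⟨mem_KH_of_mem hh ω, fun hhC => hCH h hhC hh⟩) hc
  · rintro x (⟨hxK, hxC⟩ | ⟨hxC, hxM⟩)
    · let Z : Set V := {y | y ∈ KH ends H ω → (y ∈ KH ends H ω' ∨ y ∈ C)}
      have hcl' : ∀ y ∈ Z, ∀ z, (openGraph ends ω).Adj y z → z ∈ Z := by
        intro y hy z hyz hzK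
        obtain ⟨_, e, he, hends⟩ := openGraph_adj.1 hyz
        have hyK : y ∈ KH ends H ω := mem_KH_of_open hzK he (by rw [hends, Sym2.eq_swap])
        by_cases hzC : z ∈ C
        · exact Or.inr hzC
        by_cases hyC : y ∈ C
        · exact Or.inl (mem_KH_of_mem (hstep hends hyC (Or.inl hzK) hzC) ω')
        rcases hy hyK with hyK' | hyC'
        · have hnt : e ∉ touches ends C := not_mem_touches_of_ends hends hyC hzC
          have he1 : ω' e = true := by rw [hnot hnt]; exact he
          exact Or.inl (mem_KH_of_open hyK' he1 hends)
        · exact (hyC hyC').elim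
      have hxZ : x ∈ Z := by
        obtain ⟨h, hh, hc⟩ := hxK
        exact mem_of_conn_of_closed hcl' (fun _ => Or.inl (mem_KH_of_mem hh ω')) hc
      rcases hxZ hxK with h1 | h1
      · exact h1
      · exact (hxC h1).elim
    · -- `C ∩ M_H ⊆ K_H(ω')`: the closed path from a terminal into `C` becomes open
      let Z : Set V := {y | y ∈ MH ends H ω → y ∈ C → y ∈ KH ends H ω'}
      have hcl' : ∀ y ∈ Z, ∀ z, (openGraph ends (OneColourSwitch.compl ω)).Adj y z → z ∈ Z := by
        intro y hy z hyz hzM hzC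
        obtain ⟨_, e, he, hends⟩ := openGraph_adj.1 hyz
        have he0 : ω e = false := by simpa [OneColourSwitch.compl] using he
        have hzy : ends e = s(z, y) := by rw [hends, Sym2.eq_swap]
        have hyM : y ∈ MH ends H ω := mem_MH_of_closed hzM he0 hzy
        have het : e ∈ touches ends C := mem_touches_of_ends hends (Or.inr hzC)
        have he1 : ω' e = true := by rw [hmem het, he0]; rfl
        have key : y ∈ KH ends H ω' → z ∈ KH ends H ω' := fun hy' =>
          mem_KH_of_open hy' he1 hends
        by_cases hyC : y ∈ C
        · exact key (hy hyM hyC)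
        · exact key (mem_KH_of_mem (hstep hzy hzC (Or.inr hyM) hyC) ω')
      have hxZ : x ∈ Z := by
        obtain ⟨h, hh, hc⟩ := hxM
        exact mem_of_conn_of_closed hcl' (fun _ hhC => (hCH h hhC hh).elim) hc
      exact hxZ hxM hxC

/-- **The side switch of a closed set, `W`-world**: `M_H(ω ⊕ touches C) = (M_H ∖ C) ∪ (C ∩ K_H)`. -/
theorem MH_flipTouch_of_closed {H : Set V} {ω : Config E}
    {C : Set V} (hCH : ∀ x ∈ C, x ∉ H) (hcl : ClosedIn ends (sidedH ends H ω) C) :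
    MH ends H (flipTouch ends C ω) = (MH ends H ω \ C) ∪ (C ∩ KH ends H ω) := by
  rw [MH, ← KH, compl_flipTouch]
  have hcl' : ClosedIn ends (sidedH ends H (OneColourSwitch.compl ω)) C := by
    rw [sidedH_compl]; exact hcl
  rw [KH_flipTouch_of_closed hCH hcl', KH_compl, MH_compl]

/-- The side switch of a closed set preserves `sepH`. -/
theorem sepH_flipTouch_of_closed {p q : V} {H : Set V} {ω : Config E} (h : sepH ends p q H ω)
    {C : Set V} (hC : C ⊆ KH ends H ω ∪ MH ends H ω) (hCH : ∀ x ∈ C, x ∉ H)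
    (hcl : ClosedIn ends (sidedH ends H ω) C) : sepH ends p q H (flipTouch ends C ω) := by
  have hK := KH_flipTouch_of_closed hCH hcl
  have hM := MH_flipTouch_of_closed hCH hcl
  obtain ⟨hpK, hqK, hpM, hqM⟩ := h
  have hpC : p ∉ C := fun hp => by
    rcases hC hp with h' | h'
    · exact hpK h'
    · exact hpM h'
  have hqC : q ∉ C := fun hq => by
    rcases hC hq with h' | h'
    · exact hqK h'
    · exact hqM h'
  rw [sepH, hK, hM]
  refine ⟨?_, ?_, ?_, ?_⟩
  · rintro (⟨h', _⟩ | ⟨h', _⟩)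
    · exact hpK h'
    · exact hpC h'
  · rintro (⟨h', _⟩ | ⟨h', _⟩)
    · exact hqK h'
    · exact hqC h'
  · rintro (⟨h', _⟩ | ⟨h', _⟩)
    · exact hpM h'
    · exact hpC h'
  · rintro (⟨h', _⟩ | ⟨h', _⟩)
    · exact hqM h'
    · exact hqC h'

/-- `K_H ∪ M_H` is preserved by the side switch of a closed set. -/
lemma UH_flipTouch_of_closed {H : Set V} {ω : Config E}
    {C : Set V} (hCH : ∀ x ∈ C, x ∉ H) (hcl : ClosedIn ends (sidedH ends H ω) C) :
    KH ends H (flipTouch ends C ω) ∪ MH ends H (flipTouch ends C ω) =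
      KH ends H ω ∪ MH ends H ω := by
  rw [KH_flipTouch_of_closed hCH hcl, MH_flipTouch_of_closed hCH hcl]
  ext x
  constructor
  · rintro ((⟨hx, _⟩ | ⟨_, hx⟩) | (⟨hx, _⟩ | ⟨_, hx⟩))
    · exact Or.inl hx
    · exact Or.inr hx
    · exact Or.inr hx
    · exact Or.inl hx
  · intro hx
    by_cases hxC : x ∈ C
    · rcases hx with hx | hx
      · exact Or.inr (Or.inr ⟨hxC, hx⟩)
      · exact Or.inl (Or.inr ⟨hxC, hx⟩)
    · rcases hx with hx | hx
      · exact Or.inl (Or.inl ⟨hx, hxC⟩)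
      · exact Or.inr (Or.inl ⟨hx, hxC⟩)

/-- The sided set is preserved by the side switch of a closed set. -/
lemma sidedH_flipTouch_of_closed {H : Set V} {ω : Config E}
    {C : Set V} (hCH : ∀ x ∈ C, x ∉ H) (hcl : ClosedIn ends (sidedH ends H ω) C) :
    sidedH ends H (flipTouch ends C ω) = sidedH ends H ω := by
  ext x
  simp only [sidedH, Set.mem_setOf_eq]
  rw [UH_flipTouch_of_closed hCH hcl]

end TermSwitch

end Summit.Ventures.PercRepro2
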